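import Literature.NumberTheory.Transcendental.RoyPadicRank
import Literature.NumberTheory.Transcendental.RoyRankGenericThm4
import HarnessLib

/-!
# Roy 1992, Theorem 4 for `K = ℚ̄_p` REDUCED to Theorem 2 for `ℚ̄_p` (Roy's proof of §4, field-generic)

Proof companion of `Literature/NumberTheory/Transcendental/RoyPadicRank.lean`, whose named fact
`roy1992_padic_thm4` is Roy's Theorem 4 [Roy1992, §4 p. 34] for the `p`-adic field
`K = ℚ̄_p = PadicAlgCl p`, `ℚ̄ = padicQbar p`, `𝓛̃ = RoyPadic.logLinearForms p`. In print Theorem 4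
is deduced (§4, pp. 34–37) from Theorem 2, itself deduced (§§2–3) from **Theorem 1 = M. Waldschmidt's
Theorem 4.1 of [Waldschmidt1988] for the group `G_a^{d₀} × G_m^{d₁}`**, over `K = ℂ` and over
`K = ℂ_p` alike ("we denote by `ω` the element of `L` equal to `2πi` if `K = ℂ`, equal to `0`
otherwise", Notations p. 24). The tree proves both deductions ONCE over general data
`(K, F, L, ω)` (`Literature.NumberTheory.Transcendental.RoyRankGeneric*`:
`RoyRank.thm4_of_thm2` in `…RoyRankGenericThm4`, and `RoyRank.thm2_of_thm1` in `…RoyRankGenericThm2`);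
this file draws the `p`-adic instance `K = ℚ̄_p`, `F = ℚ̄ = padicQbar p`,
`L = RoyPadic.logQSpan p` (Roy's `L`) of the second deduction:

* `logLinearForms_eq_linForms` — the tree's `𝓛̃` is `F + F·L` (`RoyRank.linForms`);
* `roy1992_padic_thm4_of_thm4Generic` / `thm4Generic_of_roy1992_padic_thm4` — the named fact IS the
  instance of the generic predicate `RoyRank.Thm4`;
* `roy1992_padic_thm4_of_thm2Generic` — **`RoyRank.Thm2 (padicQbar p) (logQSpan p) ω →
  roy1992_padic_thm4 p`** (any `ω`; the printed one is `ω = 0`): Roy's Theorem 4 for `ℚ̄_p` from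
  Roy's Theorem 2 for `ℚ̄_p`, by Roy's own §4 proof.

The companion `RoyPadicRankThm4OfWaldschmidt.lean` composes with `RoyRank.thm2_of_thm1` (§§2–3) to
put `roy1992_padic_thm4` (and `thm5`, `cor1`, the `p`-adic strong six exponentials theorem) on the
`p`-adic case of Waldschmidt's Theorem 1 alone. (`ℚ̄_p` versus the printed `ℂ_p`: see the header of
`RoyPadicRank.lean` — the statements restrict Roy's to subspaces defined over `ℚ̄_p`, and the proof
is verbatim the same over any field of characteristic `0`.)

## References

* [Roy1992] D. Roy, *Matrices whose coefficients are linear forms in logarithms*, J. Number Theory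
  41 (1992) 22–47: Notations (p. 24); §1 Theorems 1–2 (p. 25); §§2–3; §4 Theorem 4 (p. 34) and its
  proof (pp. 34–37); Remark (i) (p. 37).
* [Waldschmidt1988] M. Waldschmidt, *On the transcendence methods of Gel'fond and Schneider in
  several variables*, New Advances in Transcendence Theory (1988), §4 Thm 4.1.
-/

noncomputable section

open Module

namespace Literature.NumberTheory.Transcendental

open RoyPadic

variable (p : ℕ) [Fact p.Prime]

/-- **`𝓛̃ = ℚ̄ + ℚ̄·L`**: the tree's `RoyPadic.logLinearForms p` (the `ℚ̄`-span of `1` and the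
logarithms of algebraic principal units) is `RoyRank.linForms (padicQbar p) (logQSpan p)` (the
`ℚ̄`-span of `1` and of Roy's `L`, the `ℚ`-span of those logarithms).
[cite: Roy1992, Notations (p. 24)] -/
theorem logLinearForms_eq_linForms :
    logLinearForms p = RoyRank.linForms (padicQbar p) (logQSpan p) := by
  apply le_antisymm
  · refine Submodule.span_le.2 ?_
    rintro x (hx | hx)
    · rw [Set.mem_singleton_iff.1 hx]
      exact RoyRank.one_mem_linForms _ _
    · exact RoyRank.mem_linForms_of_mem _ _ (Submodule.subset_span hx)
  · refine Submodule.span_le.2 ?_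
    rintro x (hx | hx)
    · rw [Set.mem_singleton_iff.1 hx]
      exact one_mem_logLinearForms p
    · exact logQSpan_le p hx

/-- The named fact `roy1992_padic_thm4 p` is the `p`-adic instance of the generic predicate
`RoyRank.Thm4` (`K = ℚ̄_p`, `F = ℚ̄`, `F + F·L = 𝓛̃`). [cite: Roy1992, §4 Theorem 4 (p. 34)] -/
theorem roy1992_padic_thm4_of_thm4Generic (h : RoyRank.Thm4 (padicQbar p) (logQSpan p)) :
    roy1992_padic_thm4 p := by
  intro d hd Z U hfin hZ hZU d' t ht hrat hne hmin
  have hZ' : ∀ z ∈ Z, ∀ i, z i ∈ RoyRank.linForms (padicQbar p) (logQSpan p) := by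
    rw [← logLinearForms_eq_linForms]; exact hZ
  exact h d hd Z U hfin hZ' hZU d' t ht hrat hne hmin

/-- Conversely, the generic predicate at the `p`-adic data is the named fact (they are the same
statement). [cite: Roy1992, §4 Theorem 4 (p. 34)] -/
theorem thm4Generic_of_roy1992_padic_thm4 (h : roy1992_padic_thm4 p) :
    RoyRank.Thm4 (padicQbar p) (logQSpan p) := by
  intro d hd Z U hfin hZ hZU d' t ht hrat hne hmin
  have hZ' : ∀ z ∈ Z, ∀ i, z i ∈ logLinearForms p := by
    rw [logLinearForms_eq_linForms]; exact hZ
  exact h d hd Z U hfin hZ' hZU d' t ht hrat hne hmin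

/-- **Roy's Theorem 4 for `ℚ̄_p` from Roy's Theorem 2 for `ℚ̄_p`** (any `ω`; the printed `ω` is `0`):
the `p`-adic instance of `RoyRank.thm4_of_thm2` (§4, pp. 34–37).
[cite: Roy1992, §4 Theorem 4 and its proof (pp. 34–37)] -/
theorem roy1992_padic_thm4_of_thm2Generic {ω : PadicAlgCl p}
    (h : RoyRank.Thm2 (padicQbar p) (logQSpan p) ω) : roy1992_padic_thm4 p :=
  -- `ℚ̄ = padicQbar p = algebraicClosure ℚ ℚ̄_p` is algebraic over `ℚ`: membership unfolds to
  -- `IsIntegral ℚ x` (`mem_algebraicClosure_iff'`), whence Mathlib's `IsIntegral.isAlgebraic`.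
  roy1992_padic_thm4_of_thm4Generic p
    (RoyRank.thm4_of_thm2 h fun _ hx => IsIntegral.isAlgebraic hx)

end Literature.NumberTheory.Transcendental
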